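import Summits.CriticalPhenomena.CardyFormulaZ2.Theses.CardyUSTContinuation
import Literature.Probability.RandomPlanarGeometry.MillerWernerHookup

/-!
# `SmallFugacityLimit` (route CardyUSTContinuation of `CardyFormulaZ2`, crux stmt-CriticalPhenomena-6048):
the candidate limit passes the two EXACT lattice constraints (continuum-side checks)

Helper file (supports stmt-CriticalPhenomena-6048; it closes nothing). The crux asserts that the
jointly-wired self-dual FK(`p = t/(1+t)`, `q = t²`) crossing probabilities `uJ R t δ` of a conformal
rectangle converge, for small `t`, to the Miller–Werner function in joint wiring
`U(t, η) = t Z(η) / (Z(1-η) + t Z(η))`, `Z(x) = x^{u/2} (1-x)^{1-3u/2} ₂F₁(u, 1-u; 2u; x)`,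
`u = arccos(-t/2)/π` (`smallFugacityLimit_iff_Umw` below is `Iff.rfl`: the abbrevs of this file are the
crux's `let`s verbatim).

Two identities hold EXACTLY on the lattice at every mesh (planar self-duality of FK at `p_sd(t²)` plus
the joint/separate wiring identity `P_sep = P_joint / (P_joint + t² (1 - P_joint))`; see the crux
workfile `Cruxes/SmallFugacityLimit/NUMERICS-falsifier3.md`, identities 2 and 4, verified there by an
exact transfer matrix), hence constrain ANY crossing limit `V(t, ·)` of the family:
`V(t, ½) = t/(1+t)` (conformal square) and the duality equation
`V(t, η) = 1 - V(t, 1-η) / (V(t, 1-η) + t² (1 - V(t, 1-η)))`.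
This file proves, sorry-free, that the crux's candidate `U` satisfies both (`Umw_one_half`,
`Umw_duality`) and takes genuine values in `(0, 1)` on the intended range `t ∈ (0, 2)`, `η ∈ (0, 1)`
(`Umw_mem_Ioo`: no Mathlib junk value of `Real.rpow` / `₂F₁` / `Real.arccos` interferes), i.e. the
Miller–Werner transposition used by the route is consistent with the only constraints the lattice
imposes for free. [cite: MillerWerner2018, Thm 1 and App. A]
-/

noncomputable section

namespace Summit.CriticalPhenomena.CardyFormulaZ2.Theorems

namespace SmallFugacityContinuum

open Set Filter Topology
open Literature.Probability.RandomPlanarGeometry (ConformalRectangle ConformalEquiv crossRatio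
  one_le_ordinaryHypergeometric_of_nonneg)
open Literature.Probability.LatticeModels (fkDomainMeasure meshDomain_finite)
open Literature.Probability.Percolation (discreteCrossing)

/-- Miller–Werner's `Z(x) = x^(u/2) (1−x)^(1−3u/2) ₂F₁(u, 1−u; 2u; x)`, `u = 4/κ`
(verbatim `Z` of the crux `SmallFugacityLimit`). [cite: MillerWerner2018, §4] -/
abbrev Zmw : ℝ → ℝ → ℝ := fun u x =>
  x ^ (u / 2) * (1 - x) ^ (1 - 3 * u / 2) * ₂F₁ u (1 - u) (2 * u) x

/-- The Miller–Werner `CLE_κ(t)` connection function in JOINT wiring,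
`U(t, η) = t Z(η)/(Z(1−η) + t Z(η))`, `u = arccos(−t/2)/π` (verbatim `U` of the crux).
[cite: MillerWerner2018, Thm 1] -/
abbrev Umw : ℝ → ℝ → ℝ := fun t η =>
  t * Zmw (Real.arccos (-(t / 2)) / Real.pi) η /
    (Zmw (Real.arccos (-(t / 2)) / Real.pi) (1 - η) + t * Zmw (Real.arccos (-(t / 2)) / Real.pi) η)

/-- The jointly-wired self-dual FK(`p = t/(1+t)`, `q = t²`) probability of G02's crossing event of
`Ω_δ` between the discrete arcs of `R.arc 0` and `R.arc 2` (verbatim `uJ` of the crux; junk `0` for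
`δ ≤ 0`). [cite: Smirnov2001, §2] -/
abbrev uJ : ConformalRectangle → ℝ → ℝ → ℝ := fun R t δ =>
  if h : 0 < δ then
    (@fkDomainMeasure R.carrier δ (t / (1 + t)) (t ^ 2) (R.arc 0 ∪ R.arc 2)
      (meshDomain_finite R.isBounded h).fintype).real (discreteCrossing R.carrier δ (R.arc 0) (R.arc 2))
  else 0

/-- The abbrevs of this file ARE the crux's objects: `SmallFugacityLimit` unfolds to them
definitionally. [cite: MillerWerner2018, Thm 1] -/
theorem smallFugacityLimit_iff_Umw :
    Summit.CriticalPhenomena.CardyFormulaZ2.Theses.CardyUSTContinuation.SmallFugacityLimit ↔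
      ∀ R : ConformalRectangle, ∃ t₀ > (0:ℝ), ∀ t ∈ Set.Ioo 0 t₀,
        R.HasCrossingLimit (fun δ => uJ R t δ) (Umw t) :=
  Iff.rfl

/-- For `t ∈ (0, 2)` the Miller–Werner exponent `u = arccos(−t/2)/π = 4/κ(t)` lies in `(1/2, 1)`
(`κ(t) ∈ (4, 8)`). [folklore] -/
theorem arccos_div_pi_mem_Ioo {t : ℝ} (ht : t ∈ Ioo (0:ℝ) 2) :
    Real.arccos (-(t / 2)) / Real.pi ∈ Ioo (1 / 2 : ℝ) 1 := by
  have hπ := Real.pi_pos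
  constructor
  · rw [lt_div_iff₀ hπ]
    have : Real.pi / 2 < Real.arccos (-(t / 2)) := by
      rw [← not_le]
      intro hle
      have h0 : (0:ℝ) ≤ -(t / 2) := Real.arccos_le_pi_div_two.1 hle
      linarith [ht.1]
    linarith
  · rw [div_lt_one hπ]
    have h1 : -1 < -(t / 2) := by linarith [ht.2]
    exact Real.arccos_lt_pi.2 h1

/-- `Z_u(y) > 0` for `u ∈ [0, 1]`, `u > 0` and `y ∈ (0, 1)`: the Gauss parameters `(u, 1−u; 2u)` are
admissible, so `₂F₁ ≥ 1` on `[0,1)`, and the `rpow` bases are positive. [folklore] -/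
theorem Zmw_pos {u y : ℝ} (hu0 : 0 < u) (hu1 : u ≤ 1) (hy : y ∈ Ioo (0:ℝ) 1) : 0 < Zmw u y := by
  have ha : 0 ≤ u := hu0.le
  have hb : 0 ≤ 1 - u := by linarith
  have hc : 0 < 2 * u := by linarith
  have hF := one_le_ordinaryHypergeometric_of_nonneg ha hb hc hy.1.le hy.2
  have h1 : 0 < y ^ (u / 2) := Real.rpow_pos_of_pos hy.1 _
  have h2 : 0 < (1 - y) ^ (1 - 3 * u / 2) := Real.rpow_pos_of_pos (by linarith [hy.2]) _
  have h3 : 0 < ₂F₁ u (1 - u) (2 * u) y := by linarith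
  show 0 < y ^ (u / 2) * (1 - y) ^ (1 - 3 * u / 2) * ₂F₁ u (1 - u) (2 * u) y
  positivity

/-- No junk values in range: for `t ∈ (0, 2)` and `η ∈ (0, 1)`, `0 < U(t, η) < 1`. [folklore] -/
theorem Umw_mem_Ioo {t η : ℝ} (ht : t ∈ Ioo (0:ℝ) 2) (hη : η ∈ Ioo (0:ℝ) 1) :
    Umw t η ∈ Ioo (0:ℝ) 1 := by
  set u : ℝ := Real.arccos (-(t / 2)) / Real.pi with hu
  have hu' := arccos_div_pi_mem_Ioo ht
  have hA : 0 < Zmw u η := Zmw_pos (by linarith [hu'.1]) hu'.2.le hη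
  have hB : 0 < Zmw u (1 - η) :=
    Zmw_pos (by linarith [hu'.1]) hu'.2.le ⟨by linarith [hη.2], by linarith [hη.1]⟩
  have hnum : 0 < t * Zmw u η := mul_pos ht.1 hA
  have hden : 0 < Zmw u (1 - η) + t * Zmw u η := by linarith
  show t * Zmw u η / (Zmw u (1 - η) + t * Zmw u η) ∈ Ioo (0:ℝ) 1
  exact ⟨div_pos hnum hden, (div_lt_one hden).2 (by linarith)⟩

/-- **Square value.** `U(t, ½) = t/(1+t) = p_sd(t²)` for `t ∈ (0, 2)` — the value forced on any
jointly-wired crossing limit of a conformal square by self-duality and the wiring identity (on the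
lattice, the jointly-wired `L × (L+1)` box has crossing probability exactly `t/(1+t)` for every `L`;
Miller–Werner's `1/(1+θ)` is the separately-wired value). [cite: MillerWerner2018, Thm 1 and App. A] -/
theorem Umw_one_half {t : ℝ} (ht : t ∈ Ioo (0:ℝ) 2) : Umw t (1 / 2) = t / (1 + t) := by
  set u : ℝ := Real.arccos (-(t / 2)) / Real.pi with hu
  have hu' := arccos_div_pi_mem_Ioo ht
  have hhalf : (1 / 2 : ℝ) ∈ Ioo (0:ℝ) 1 := ⟨by norm_num, by norm_num⟩
  have hZ : 0 < Zmw u (1 / 2) := Zmw_pos (by linarith [hu'.1]) hu'.2.le hhalf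
  show t * Zmw u (1 / 2) / (Zmw u (1 - 1 / 2) + t * Zmw u (1 / 2)) = t / (1 + t)
  rw [show (1 : ℝ) - 1 / 2 = 1 / 2 by norm_num]
  have ht0 := ht.1
  have ht1 : 0 < 1 + t := by linarith
  set Z := Zmw u (1 / 2) with hZdef
  have hden : 0 < Z + t * Z := by positivity
  rw [div_eq_div_iff hden.ne' ht1.ne']
  ring

/-- **Duality equation.** For `t ∈ (0, 2)` and `η ∈ (0, 1)`,
`U(t, η) = 1 − U(t, 1−η) / (U(t, 1−η) + t² (1 − U(t, 1−η)))` — the functional equation that planar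
self-duality at `p_sd(t²)` (jointly-wired arcs `0 ∪ 2` ↔ separately-wired dual arcs `1, 3`,
cross-ratio `η ↦ 1 − η`) together with the exact joint/separate wiring identity imposes on every
crossing limit of the family; the candidate `U` satisfies it identically (with `a = Z(η)`,
`b = Z(1−η)`: both sides equal `t a/(b + t a)`). [cite: MillerWerner2018, App. A] -/
theorem Umw_duality {t η : ℝ} (ht : t ∈ Ioo (0:ℝ) 2) (hη : η ∈ Ioo (0:ℝ) 1) :
    Umw t η = 1 - Umw t (1 - η) / (Umw t (1 - η) + t ^ 2 * (1 - Umw t (1 - η))) := by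
  set u : ℝ := Real.arccos (-(t / 2)) / Real.pi with hu
  have hu' := arccos_div_pi_mem_Ioo ht
  have hη' : (1 - η) ∈ Ioo (0:ℝ) 1 := ⟨by linarith [hη.2], by linarith [hη.1]⟩
  have hA : 0 < Zmw u η := Zmw_pos (by linarith [hu'.1]) hu'.2.le hη
  have hB : 0 < Zmw u (1 - η) := Zmw_pos (by linarith [hu'.1]) hu'.2.le hη'
  have ht0 := ht.1
  show t * Zmw u η / (Zmw u (1 - η) + t * Zmw u η) =
    1 - t * Zmw u (1 - η) / (Zmw u (1 - (1 - η)) + t * Zmw u (1 - η)) /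
      (t * Zmw u (1 - η) / (Zmw u (1 - (1 - η)) + t * Zmw u (1 - η)) +
        t ^ 2 * (1 - t * Zmw u (1 - η) / (Zmw u (1 - (1 - η)) + t * Zmw u (1 - η))))
  rw [sub_sub_cancel]
  set a := Zmw u η with ha
  set b := Zmw u (1 - η) with hb
  have h1 : 0 < b + t * a := by positivity
  have h2 : 0 < a + t * b := by positivity
  have hinner : t * b / (a + t * b) + t ^ 2 * (1 - t * b / (a + t * b)) =
      t * (b + t * a) / (a + t * b) := by
    field_simp
    ring
  rw [hinner]
  have h3 : 0 < t * (b + t * a) / (a + t * b) := by positivity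
  field_simp
  ring

end SmallFugacityContinuum

end Summit.CriticalPhenomena.CardyFormulaZ2.Theorems

end
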